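import Mathlib
import HarnessLib
import HarnessLib.Audit
import Summits.PneNP.Statement
import Literature.Computability.MetaComplexity.Magnification
import Literature.Computability.MetaComplexity.MCSP
import Literature.Computability.MetaComplexity.UniversalMachine
import Literature.Computability.Complexity.Classes
import HarnessLib.Audit.Status.Attr

/-!
Route: UniformStream

# Route UniformStream — Uniformity is the missing hypothesis — P ≠ NP from a one-pass, small-space,
honest-time lower bound for MCSP[s] (MMW19 Thm 1.3, re-typed after stmt-0265)

RESCUER route (lens cycle 1; corpses: stmt-PneNP-0265 refuted-misstated and DROPPED by
route-PneNP-Circuit; closed card nerode-automaton-of-compressibility declined for mis-citing MMW's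
Kt bullet; literature: hardness magnification stalled at the locality barrier). It suffices to show
X = UniformStreamLB: there is a time-constructible size function s (so s(n) ≥ n) such that for every
c the parametrised Minimum Circuit Size Problem MCSP[s] (tree `MCSPSize s`, truth tables of length N
= 2^n) is decided by NO UNIFORM one-pass streaming algorithm with space and per-bit update time
s(⌊log₂N⌋)^c + c — "uniform" meaning ONE Mathlib TM2 machine (fixed finite control, hence honest
step counts), quantified BEFORE ∀N, for each of init (input: N in binary), update (input: ⟨state,
bit⟩) and accept (input: final state). By McKay–Murray–Williams 2019, Thm 1.3 (typed here as the
crux UniformMagnification) X ⇒ P ≠ NP directly, with no passage through NP ⊄ P/poly. X is the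
weakest statement known to magnify to the summit: exponentially hard OWFs ⇒ route Learning's thesis
⇒ (CIKK16) MCSP[2^{εn}] has no P-natural decider ⇒ X ⇒ (MMW) P ≠ NP.
Lean: `∃ s : ℕ → ℕ, Literature.Computability.Complexity.IsTimeConstructible s ∧ ∀ c : ℕ, ¬ ∃ (A :
Literature.Computability.MetaComplexity.StreamingAlgorithm) (M₀ M₁ M₂ : Turing.TM2ComputableAux Bool
Bool), A.HasSpace (fun N => s (Nat.log 2 N) ^ c + c) ∧ (∀ N : ℕ, M₀.OutputsWithin
(Computability.encodeNat N) (A.init N) (s (Nat.log 2 N) ^ c + c)) ∧ (∀ (N : ℕ) (st : List Bool) (b :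
Bool), st.length ≤ s (Nat.log 2 N) ^ c + c → M₁.OutputsWithin
(Literature.Computability.Complexity.boolPair st [b]) (A.update N st b) (s (Nat.log 2 N) ^ c + c)) ∧
(∀ (N : ℕ) (st : List Bool), st.length ≤ s (Nat.log 2 N) ^ c + c → M₂.OutputsWithin st
(Computability.encodeBool (A.accept N st)) (s (Nat.log 2 N) ^ c + c)) ∧ A.Decides
(Literature.Computability.MetaComplexity.MCSPSize s)`

## Assembly
Pure logic: `closes (hlb : UniformStreamLB) (hmag : UniformMagnification) : PneNP` — by
contradiction, ¬PneNP and hmag give, for the s of hlb, some c and a uniform streaming algorithm,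
which hlb c forbids (checked in Sketch.lean, rc 0). DodgeNonuniformity is the rank-3 rung
(UniformStreamLB → DodgeNonuniformity, `dodge_of_lb` in Sketch.lean) and is not a hypothesis of
`closes`; the two supports are calibration theorems.

Rationale: WHY THIS LINE. The magnification programme (Oliveira–Santhanam 2018, MckayMurrayWilliams2019,
Chen–Jin–Williams 2019) reduced P ≠ NP to barely-superlinear lower bounds for sparse compression
problems and then stalled at LOCALITY (arXiv191108297, Thm 2 and §1.3): every known weak-circuit
lower-bound technique extends to circuits with a few small-fan-in oracle gates, and the magnified
problems HAVE such oracle circuits (MMW Thm 1.1/1.2; CheraghchiEtAl2022 Thm 3 even forbids MMW-style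
magnification above s = 2^{n/2}). Our own tree added a sharper death for the STREAMING frontier:
stmt-PneNP-0265 typed MMW's streaming hypothesis non-uniformly (a machine per N, one TM2 step =
arbitrary map) and `Circuit2CircuitMagnificationFrontier_refuted` proved it FALSE for every s ≥ n —
at magnification thresholds the yes-set is so sparse that a Myhill–Nerode automaton with s^60+60
state bits exists, so information is never the obstruction, only the cost of running that automaton
uniformly. The repair is the missing hypothesis itself: one finite machine for all N with honest
time. This moves the problem out of circuit complexity into UNIFORM time–space lower bounds, the one
arena where super-linear bounds for NP problems exist unconditionally (Fortnow–Lipton–van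
Melkebeek–Viglas, doi:10.1145/1101821.1101822: SAT ∉ DTISP(n^c, n^o(1)), c < 2cos(π/7)) and where
arXiv191108297 §1.4 itself locates the exit from locality: Oliveira2019 Thm 1 proves MrKtP ∉
BPTIME[n^polylog] by an indirect diagonalization that provably does not extend to short-oracle
machines. What no prior route does: Circuit (#5R) bets on non-uniform SIZE bounds (locality-barred,
→ NP ⊄ P/poly); ktlang/MetaCplx bet on full polynomial-time hardness of K^t languages; here the
claim is about a single finite object — a one-pass machine with N^o(1) memory — and the negatives
index certifies that nothing weaker than its finiteness can be used.

RANKED CRUXES. #2 UniformStreamLB (crux) — [crux] X itself (MMW19 Thm 1.3 hypothesis, decision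
version, oracle A = ∅): some time-constructible s has MCSP[s] outside uniform one-pass streaming
with space and update time s(⌊log₂N⌋)^c + c for every c; the three ∃-machines stand before ∀N
(uniformity), init reads `encodeNat N`, update reads `boolPair st [b]`, accept reads the final
state. [difficulty: open-problem] (why it might fail: MCSP[s] may simply be uniformly streamable
(MCSP ∈ P is consistent with everything known); and all known tools are void here —
information/Nerode arguments (non-uniform twin false: Circuit2CircuitMagnificationFrontier_refuted),
oracle-insensitive ones (MMW Thm 1.2), relativizing ones (P^A = NP^A).) [MckayMurrayWilliams2019,
CheraghchiEtAl2022, arXiv191108297, Oliveira2019, KabanetsCai2000]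
#3 DodgeNonuniformity (crux) — [crux] Dodge0265 — the first uniformity-essential rung: the c = 60
instance of X (space and update time s(⌊log₂N⌋)^60 + 60, the exponent of the banked Nerode ceiling).
Its NON-uniform twin (tree `STREAM`, machine per N) is exactly what
`Circuit2CircuitMagnificationFrontier_refuted` shows false for every s ≥ n, so any proof provably
uses the finite description of the one machine; implied by UniformStreamLB (c := 60). [deps:
UniformStreamLB] [difficulty: open-problem] (why it might fail: It is stmt-0265's c=60 instance with
one machine for all N: the non-uniform twin is FALSE for every s ≥ n (NerodeCeilingMCSP), so a proof
must exploit the machine's finite description — no one-pass lower-bound technique of that kind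
exists yet (CheraghchiEtAl2022 Thm 2 lives at s = 2^(1-o(1))n).) [MckayMurrayWilliams2019,
CheraghchiEtAl2022,
Summits/PneNP/PneNP/Theorems/Circuit2CircuitMagnificationFrontierRefutation.lean]
#4 UniformMagnification (crux) — [crux] MMW19 Thm 1.3 typed in the tree's model (contrapositive): if
¬PneNP then for every time-constructible s there are c and ONE uniform streaming algorithm
(init/update/accept TM2 machines within s(⌊log₂N⌋)^c + c space and steps) deciding MCSPSize s — via
Circuit-Min-Merge ∈ Σ₃P made polynomial-time by P = NP (MMW §1.2, §4 Algorithm 1, §5). [difficulty: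
L] (why it might fail: Published theorem, but typed over Mathlib TM2: the update machine never sees
N (must ride in the state), OutputsWithin re-reads the state, and P = NP must become an FP algorithm
for Circuit-Min-Merge via TM2 composition the tree lacks — a model mismatch falsifies the typed
form, as with 0265.) [MckayMurrayWilliams2019]
#9 NerodeCeilingMCSP (support) — [support] the dodge certificate, stated positively: for every s
with s(n) ≥ n, MCSPSize s IS in the tree's non-uniform vacuous-time class STREAM (N ↦
s(⌊log₂N⌋)^60+60) (same) — the content of Circuit2CircuitMagnificationFrontier_refuted (states
⟨|prefix|, desc C⟩ for a lex-first consistent size-s circuit; one-step per-N machines). Provable now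
by lifting that proof. [difficulty: provable-now]
[Summits/PneNP/PneNP/Theorems/Circuit2CircuitMagnificationFrontierRefutation.lean,
MckayMurrayWilliams2019]
#9 BerryFloorKt (support) — [support] the self-reference lever where it provably wins (calibration;
repairs the closed card's floor): for every efficient universal machine U, with t(N) = 2^(⌊log₂N⌋^4)
and threshold ⌊log₂N⌋^2, NO uniform one-pass streaming algorithm with space and update time
⌊log₂N⌋^3 + 3 decides MK^tP (tree `U.MKtimeP`): the lexicographically first rejected string of
length N is printed within t by breadth-first search over the ≤ 2^(log³N+4) states using the three
machines, so has K^t ≤ O(log N) < threshold, contradicting its rejection; non-uniformly ⌊log₂N⌋^2 +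
⌊log₂N⌋ + O(1) state bits suffice (Nerode), so the bound is uniformity-essential. It does NOT
magnify (the K^t merge step costs t), which is the closed card's death, kept here as a theorem about
where the lever bites. [difficulty: L] [Oliveira2019, LiVitanyi2008, MckayMurrayWilliams2019,
LiuPass2020]

TWO-LAYER PLAN. Foreseen glued splits of UniformStreamLB once a rung closes or a prover asks: (a) by
REDUCTION — `StreamHard → PaddedDTISP → UniformStreamLB` with StreamHard = "some language A hard for
NTIME(2^m) under linear-time reductions has its padded version pad(A) ⊆ {0,1}^(2^m) mapped into
MCSPSize s by a uniform one-pass poly(s)-transducer" and PaddedDTISP = "NTIME(2^m) ⊄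
DTISP(2^((1+o(1))m), 2^(o(m)))" (alternation trading at exponential scale; the padded language is
then provably outside the uniform streaming class); StreamHard is the genuinely open child
(Murray–Williams-type consequences, not contradictions, follow). (b) by ORACLE WEAKENING — MMW Thm
1.3 allows MCSP^A[s] for any A ∈ PH; the child `UniformStreamLBSat` (A = SAT, oracle gates ⟨ℓ,
SAT.sliceFn ℓ⟩ added to B₂) is a weaker hypothesis still magnifying to P ≠ NP, to be typed only
after the fan-in/size accounting of oracle gates is audited (repeated wires make arities unbounded
in the tree's `Circuit`). (c) by MODEL — decision → search version (weaker hypothesis, needs a typed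
search-streaming notion).

KILL CRITERIA. Refutation of DodgeNonuniformity by an honest uniform algorithm (one machine, s^60+60
resources, every time-constructible s) refutes UniformStreamLB as well and closes the route
`refuted:DodgeNonuniformity` — and, by MMW p.3, would also kill exponentially hard one-way
functions, so it would be news either way. Refutation of UniformMagnification can only be a MODEL
artefact (the printed theorem stands): repair by restating the uniform class (e.g. feeding N to the
update machine, separating space from time), never a kill. Refutation of UniformStreamLB with
DodgeNonuniformity standing (an algorithm for every s at SOME exponent c(s) > 60) pivots the route
to the oracle-weakened child (b) or closes it `refuted:UniformStreamLB` if the algorithm is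
oracle-robust. Mooted if MCSP ∉ P lands by any route (then UniformStreamLB is a corollary) or P ≠ NP
lands.

NOT DECOMPOSED YET. No technique crux is filed for HOW to exploit uniformity (indirect
diagonalization through a P-natural property à la Oliveira2019/CIKK16, super-critical Berry on the
machine's own state graph, alternation trading after a streaming reduction): each is a line for
crux-ideation on UniformStreamLB, not an item. The search version, the MKTP sibling (MMW Thm 1.7, KT
not in the tree) and the PH-oracle versions are deliberately not typed at open (see Two-layer plan).
Constants (60; 3, 4 in BerryFloorKt) are the banked ceiling exponent and comfortable Berry margins,
not tuned thresholds: any exponent at or above the Nerode ceiling gives an equivalent rung.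

CHEAPEST FALSIFIER. A vacuity audit of the uniform class as typed: (i) exhibit in Lean ONE uniform
streaming algorithm in the model (e.g. for "the length is a power of two" within ⌊log₂N⌋^3 + 3) to
certify the ¬∃-claims are not true for silly reasons (budgets are ≥ 1 at every N; states must stay
below a third of the space bound because OutputsWithin re-reads them — intended); (ii)
`stream_of_uniform` (Sketch.lean, proved): the uniform class sits inside the tree's STREAM, so
NerodeCeilingMCSP really is the twin; (iii) lookup: no poly(s)-space streaming or DTIME₁[N^1.01]
algorithm for MCSP[2^µn] is known for any µ (CheraghchiEtAl2022 §1; it would break OWFs,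
MckayMurrayWilliams2019 p.3). Run: (ii) done rc 0; (i),(iii) left to the first refuter.

NUMBERS. Nerode ceiling (tree): MCSPSize s ∈ STREAM(s(⌊log₂N⌋)^60+60) for all s ≥ n; explicit state
length n+2+(s+1)(8(n+s)+10) (Circuit2CircuitMagnificationFrontierRefutation.lean). MMW Thm 1.2:
one-pass streaming for search-MCSP^A[s] in Õ(s) space, Õ(s²) update, queries of length O(s log s) to
Σ₃SAT^A (p.3, p.13–14). CheraghchiEtAl2022: Thm 1 — ∃µ>0, MCSP[2^µn] ∉ DTIME₁[N^1.01] ⇒ P ≠ NP; Thm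
2 — MCSP[2^µn] ∉ BPTIME₁[N^1.99] for some µ near 1; Thm 3 — for µ > 1/2 the bound survives
N^o(1)-length oracle queries (no MMW-style magnification there). Oliveira2019 Thm 1: MrKtP[β,α,n^γ]
∉ Promise-BPTIME[n^polylog n]. FLvMV/Williams: SAT ∉ DTISP(n^c, n^o(1)) for c < 2cos(π/7) ≈ 1.8019.

DEFINITION REQUESTS. Convenience only (the items inline it): `USTREAM S T` — languages decided by a
uniform one-pass streaming algorithm (∃ init/update/accept TM2 machines before ∀N) — for
Literature/Computability/MetaComplexity/Magnification.lean next to `STREAM`; and later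
`searchUSTREAM` for the search version. Not filed at open to avoid a dependency; will be filed if a
prover asks.

Novelty: Searches (2026-08-16): `lit search` ×4 (local searchd down: ConnectionReset; s2/openalex HTTP 429;
arxiv 0 rows — recorded in NOTES); `lit read` doi:10.1145/3313276.3316396 (MMW19 pp.2–5,7,13–17),
arXiv:1911.08297 (CHOPRS p.8, §1.3–1.4), doi:10.4230/LIPIcs.ICALP.2019.32 (Oliveira19 pp.3–4),
doi:10.1007/s00224-022-10113-9 (CHMY22 pp.3–4,10,13), doi:10.1109/FOCS.2019.00077 (CJW19: paywalled,
acq-06219 filed); `lit galaxy search "Hardness Magnification for all Sparse NP Languages" --star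
all` (1 pdf hit, ECCC mirror) and `"One-tape Turing machine and branching program lower bounds for
MCSP" --star all` (same hit); `ledger negatives --problem PneNP` (5; stmt-0265 is the twin); grep of
108 open + 66 closed PneNP cards for streaming/magnification/Nerode (3/10/1 hits: closed card
nerode-automaton-of-compressibility, declined:vacuous for its Kt assembly); `lean search`
USTREAM|rKt|MKtP|UniformStream (0 defs), StreamingAlgorithm/STREAM/MKtimeP (tree). Route list: 43
open PneNP routes read (digest), levers listed in NOTES — none is a uniform machine-model lower
bound magnified to P ≠ NP; route-PneNP-Circuit #5R is the non-uniform SIZE sibling.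
Nearest prior art found: MckayMurrayWilliams2019 Thm 1.3 (the thesis is its hypothesis) and Thm 1.2
(its oracle streaming algorithm = the locality witness); CheraghchiEtAl2022 Thm 1 (uniform one-tape
corollary), Thm 2–3 (lower bounds at s = 2^(1-o(1))n and the oracle obstruction above 2^(n/2));
Oliveira2019 Thm 1/3 (uniform indirect diagonalizati  [refs: 10.1145/3313276.3316396, 10.4230/LIPIcs.ICALP.2019.32, 10.1007/s00224-022-10113-9, 10.1109/FOCS.2019.00077, 1911.08297, doi:10.1145/3313276.3316396, doi:10.4230/LIPIcs.ICALP.2019.32, doi:10.1007/s00224-022-10113-9, doi:10.1109/FOCS.2019.00077, MckayMurrayWilliams2019, CheraghchiEtAl2022, Oliveira2019]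

Barriers (technique_class: hardness-magnification, uniform-time-space, streaming): - technique_class: hardness-magnification, uniform-time-space, streaming
- Literature.Barriers.PneNP.Locality: the catalogued instance (HM frontier E, AC⁰-clique,
`Circuit.IsLocalAC`) does not literally apply — no circuit class occurs — but its logic does: MMW
Thm 1.2 streams MCSP[s] in poly(s) space with O(s log s)-length Σ₃SAT queries, so every
oracle-insensitive technique (all communication/information arguments, CHMY's crossing sequences) is
void for UniformStreamLB/DodgeNonuniformity; evasion = arXiv191108297 §1.4's own prescription, a
uniformity-exploiting indirect diagonalization (Oliveira2019 Thm 1 is the worked instance that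
provably does not extend to short-query machines).
- Literature.Barriers.PneNP.NaturalProofs: not met in form (no large constructive property is
asserted of all truth tables); inverted in substance: a uniform streaming decider for MCSP[s] would
itself be a P-natural property useful against SIZE(s), so HardPRGExist ⇒ UniformStreamLB
(RazborovRudich1997 Thm 4.1, KabanetsCai2000) — the barrier's hypothesis implies the thesis.
- Literature.Barriers.PneNP.Relativization: it does; relative to A with P^A = NP^A the relativized
MMW algorithm streams MCSP^A[s] uniformly, so UniformStreamLB^A fails and any proof is
non-relativizing (BakerGillSolovay1975); the bet is that arguments consuming the explicit finite
control of the one machine on inputs generated from it are where a non-relativizing ingredient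
(Cook–Levin locality of Circuit-Min-Merge) can enter;

sub-problem: PneNP · status: open · opened planner-plan-lens-PneNP-rescuer-v2-0 2026-08-16T16:13:51Z · rev 0 · ledger route-PneNP-UniformStream
GENERATED by the gate from the ledger (D-0016/17). Provers cite these decls: `theorem foo : Summit.PneNP.PneNP.Theses.UniformStream.<Decl> := …` in Summits/PneNP/PneNP/Theorems/<Name>.lean.
-/

namespace Summit.PneNP.PneNP.Theses.UniformStream

open scoped BigOperators Topology Manifold Classical MeasureTheory ProbabilityTheory Matrix InnerProductSpace ComplexConjugate ContinuousMap
open Filter Set Function TopologicalSpace MeasureTheory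

attribute [summit_statement] _root_.PneNP

open Literature.PNP

/-- item stmt-PneNP-16045 · crux · rank 2 · open · by planner
why it might fail: MCSP[s] may simply be uniformly streamable (MCSP ∈ P is consistent with everything known); and all known tools are void here — information/Nerode arguments (non-uniform twin false: Circuit2CircuitMagnificationFrontier_refuted), oracle-insensitive ones (MMW Thm 1.2), relativizing ones (P^A = NP^A).
sources: MckayMurrayWilliams2019, CheraghchiEtAl2022, arXiv191108297, Oliveira2019, KabanetsCai2000
[crux] [crux] X itself (MMW19 Thm 1.3 hypothesis, decision version, oracle A = ∅): some
time-constructible s has MCSP[s] outside uniform one-pass streaming with space and update time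
s(⌊log₂N⌋)^c + c for every c; the three ∃-machines stand before ∀N (uniformity), init reads
`encodeNat N`, update reads `boolPair st [b]`, accept reads the final state. [difficulty:
open-problem] -/
@[route_item "route-PneNP-UniformStream", crux]
def UniformStreamLB : Prop :=
  ∃ s : ℕ → ℕ, Literature.Computability.Complexity.IsTimeConstructible s ∧ ∀ c : ℕ, ¬ ∃ (A : Literature.Computability.MetaComplexity.StreamingAlgorithm) (M₀ M₁ M₂ : Turing.TM2ComputableAux Bool Bool), A.HasSpace (fun N => s (Nat.log 2 N) ^ c + c) ∧ (∀ N : ℕ, M₀.OutputsWithin (Computability.encodeNat N) (A.init N) (s (Nat.log 2 N) ^ c + c)) ∧ (∀ (N : ℕ) (st : List Bool) (b : Bool), st.length ≤ s (Nat.log 2 N) ^ c + c → M₁.OutputsWithin (Literature.Computability.Complexity.boolPair st [b]) (A.update N st b) (s (Nat.log 2 N) ^ c + c)) ∧ (∀ (N : ℕ) (st : List Bool), st.length ≤ s (Nat.log 2 N) ^ c + c → M₂.OutputsWithin st (Computability.encodeBool (A.accept N st)) (s (Nat.log 2 N) ^ c + c)) ∧ A.Decides (Literature.Computability.MetaComplexity.MCSPSize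 s)

/-- item stmt-PneNP-16046 · crux · rank 3 · open · by planner
why it might fail: It is stmt-0265's c=60 instance with one machine for all N: the non-uniform twin is FALSE for every s ≥ n (NerodeCeilingMCSP), so a proof must exploit the machine's finite description — no one-pass lower-bound technique of that kind exists yet (CheraghchiEtAl2022 Thm 2 lives at s = 2^(1-o(1))n).
sources: MckayMurrayWilliams2019, CheraghchiEtAl2022, Summits/PneNP/PneNP/Theorems/Circuit2CircuitMagnificationFrontierRefutation.lean
[crux] [crux] Dodge0265 — the first uniformity-essential rung: the c = 60 instance of X (space and
update time s(⌊log₂N⌋)^60 + 60, the exponent of the banked Nerode ceiling). Its NON-uniform twin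
(tree `STREAM`, machine per N) is exactly what `Circuit2CircuitMagnificationFrontier_refuted` shows
false for every s ≥ n, so any proof provably uses the finite description of the one machine; implied
by UniformStreamLB (c := 60). [deps: UniformStreamLB] [difficulty: open-problem] -/
@[route_item "route-PneNP-UniformStream"]
def DodgeNonuniformity : Prop :=
  ∃ s : ℕ → ℕ, Literature.Computability.Complexity.IsTimeConstructible s ∧ ¬ ∃ (A : Literature.Computability.MetaComplexity.StreamingAlgorithm) (M₀ M₁ M₂ : Turing.TM2ComputableAux Bool Bool), A.HasSpace (fun N => s (Nat.log 2 N) ^ 60 + 60) ∧ (∀ N : ℕ, M₀.OutputsWithin (Computability.encodeNat N) (A.init N) (s (Nat.log 2 N) ^ 60 + 60)) ∧ (∀ (N : ℕ) (st : List Bool) (b : Bool), st.length ≤ s (Nat.log 2 N) ^ 60 + 60 → M₁.OutputsWithin (Literature.Computability.Complexity.boolPair st [b]) (A.update N st b) (s (Nat.log 2 N) ^ 60 + 60)) ∧ (∀ (N : ℕ) (st : List Bool), st.length ≤ s (Nat.log 2 N) ^ 60 + 60 → M₂.OutputsWithin st (Computability.encodeBool (A.accept N st)) (s (Nat.log 2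 N) ^ 60 + 60)) ∧ A.Decides (Literature.Computability.MetaComplexity.MCSPSize s)

/-- item stmt-PneNP-16047 · crux · rank 4 · closed · proved by Summit.PneNP.PneNP.Theorems.uniformStream_uniformMagnification_proof @ f17ba671eb11 (prover) · by planner
why it might fail: Published theorem, but typed over Mathlib TM2: the update machine never sees N (must ride in the state), OutputsWithin re-reads the state, and P = NP must become an FP algorithm for Circuit-Min-Merge via TM2 composition the tree lacks — a model mismatch falsifies the typed form, as with 0265.
sources: MckayMurrayWilliams2019
[crux] [crux] MMW19 Thm 1.3 typed in the tree's model (contrapositive): if ¬PneNP then for every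
time-constructible s there are c and ONE uniform streaming algorithm (init/update/accept TM2
machines within s(⌊log₂N⌋)^c + c space and steps) deciding MCSPSize s — via Circuit-Min-Merge ∈ Σ₃P
made polynomial-time by P = NP (MMW §1.2, §4 Algorithm 1, §5). [difficulty: L] -/
@[route_item "route-PneNP-UniformStream", crux]
def UniformMagnification : Prop :=
  ¬ PneNP → ∀ s : ℕ → ℕ, Literature.Computability.Complexity.IsTimeConstructible s → ∃ (c : ℕ) (A : Literature.Computability.MetaComplexity.StreamingAlgorithm) (M₀ M₁ M₂ : Turing.TM2ComputableAux Bool Bool), A.HasSpace (fun N => s (Nat.log 2 N) ^ c + c) ∧ (∀ N : ℕ, M₀.OutputsWithin (Computability.encodeNat N) (A.init N) (s (Nat.log 2 N) ^ c + c)) ∧ (∀ (N : ℕ) (st : List Bool) (b : Bool), st.length ≤ s (Nat.log 2 N) ^ c + c → M₁.OutputsWithin (Literature.Computability.Complexity.boolPair st [b]) (A.update N st b) (s (Nat.log 2 N) ^ c + c)) ∧ (∀ (N : ℕ) (st : List Bool), st.length ≤ s (Nat.log 2 N) ^ c + c → M₂.OutputsWithin st (Computability.encodeBool (A.accept N st))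 (s (Nat.log 2 N) ^ c + c)) ∧ A.Decides (Literature.Computability.MetaComplexity.MCSPSize s)

/-- item stmt-PneNP-16048 · support · rank 9 · closed · proved by Summit.PneNP.PneNP.Theorems.uniformStream_nerodeCeilingMCSP_proof @ 6612540544a1 (prover) · by planner
sources: Summits/PneNP/PneNP/Theorems/Circuit2CircuitMagnificationFrontierRefutation.lean, MckayMurrayWilliams2019
[support] [support] the dodge certificate, stated positively: for every s with s(n) ≥ n, MCSPSize s
IS in the tree's non-uniform vacuous-time class STREAM (N ↦ s(⌊log₂N⌋)^60+60) (same) — the content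
of Circuit2CircuitMagnificationFrontier_refuted (states ⟨|prefix|, desc C⟩ for a lex-first
consistent size-s circuit; one-step per-N machines). Provable now by lifting that proof.
[difficulty: provable-now] -/
@[route_item "route-PneNP-UniformStream"]
def NerodeCeilingMCSP : Prop :=
  ∀ s : ℕ → ℕ, (∀ n : ℕ, n ≤ s n) → Literature.Computability.MetaComplexity.MCSPSize s ∈ Literature.Computability.MetaComplexity.STREAM (fun N => s (Nat.log 2 N) ^ 60 + 60) (fun N => s (Nat.log 2 N) ^ 60 + 60)

/-- item stmt-PneNP-16049 · support · rank 9 · open · by planner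
sources: Oliveira2019, LiVitanyi2008, MckayMurrayWilliams2019, LiuPass2020
[support] [support] the self-reference lever where it provably wins (calibration; repairs the closed
card's floor): for every efficient universal machine U, with t(N) = 2^(⌊log₂N⌋^4) and threshold
⌊log₂N⌋^2, NO uniform one-pass streaming algorithm with space and update time ⌊log₂N⌋^3 + 3 decides
MK^tP (tree `U.MKtimeP`): the lexicographically first rejected string of length N is printed within
t by breadth-first search over the ≤ 2^(log³N+4) states using the three machines, so has K^t ≤ O(log
N) < threshold, contradicting its rejection; non-uniformly ⌊log₂N⌋^2 + ⌊log₂N⌋ + O(1) state bits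
suffice (Nerode), so the bound is uniformity-essential. It does NOT magnify (the K^t merge step
costs t), which is the closed card's death, kept here as a theorem about where the lever bites.
[difficulty: L] -/
@[route_item "route-PneNP-UniformStream"]
def BerryFloorKt : Prop :=
  ∀ U : Literature.Computability.MetaComplexity.UniversalMachine, ¬ ∃ (A : Literature.Computability.MetaComplexity.StreamingAlgorithm) (M₀ M₁ M₂ : Turing.TM2ComputableAux Bool Bool), A.HasSpace (fun N => Nat.log 2 N ^ 3 + 3) ∧ (∀ N : ℕ, M₀.OutputsWithin (Computability.encodeNat N) (A.init N) (Nat.log 2 N ^ 3 + 3)) ∧ (∀ (N : ℕ) (st : List Bool) (b : Bool), st.length ≤ Nat.log 2 N ^ 3 + 3 → M₁.OutputsWithin (Literature.Computability.Complexity.boolPair st [b]) (A.update N st b) (Nat.log 2 N ^ 3 + 3)) ∧ (∀ (N : ℕ) (st : List Bool), st.length ≤ Nat.log 2 N ^ 3 + 3 → M₂.OutputsWithin st (Computability.encodeBool (A.accept N st)) (Nat.log 2 N ^ 3 + 3)) ∧ A.Decides (U.MKtimeP (fun N => 2 ^ (Nat.log 2 N ^ 4)) (fun N => Nat.log 2 N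 ^ 2))

/-- item stmt-PneNP-16050 · assembly · rank 1 · closed · proved by Summit.PneNP.PneNP.Theorems.uniformStream_assembly_proof @ c93395da820c (prover) · by planner
sources: MckayMurrayWilliams2019
[assembly] UniformStreamLB → UniformMagnification → PneNP -/
@[route_item "route-PneNP-UniformStream"]
def Assembly : Prop :=
  UniformStreamLB → UniformMagnification → PneNP

/-! D-0027 §2.1 — DECIDING THEOREM (planner-authored via `route open/edit --closes-file`; by planner-plan-lens-PneNP-rescuer-v2-0 2026-08-16T16:13:51Z):
its hypotheses are this route's items and its conclusion the sub-problem Statement (glue_lint), and it elaborates with this file. -/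

@[closes "route-PneNP-UniformStream"] theorem closes (hlb : UniformStreamLB) (hmag : UniformMagnification) : PneNP := by
  by_contra hP
  obtain ⟨s, hs, hno⟩ := hlb
  obtain ⟨c, A, M₀, M₁, M₂, h⟩ := hmag hP s hs
  exact hno c ⟨A, M₀, M₁, M₂, h⟩

end Summit.PneNP.PneNP.Theses.UniformStream
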